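import Mathlib
import Summits.NavierStokesRegularity.NavierStokesRegularity.Theorems.EulerZoomLiouvillePowerGaugeEulerLiouvilleSelfSimilarBernoulliSqueezeVorticalMember
import Summits.NavierStokesRegularity.NavierStokesRegularity.Theorems.EulerZoomLiouvillePowerGaugeEulerLiouvilleSelfSimilarBernoulliSqueezeMember
import Summits.NavierStokesRegularity.NavierStokesRegularity.Theorems.EulerZoomLiouvillePowerGaugeEulerLiouvilleSelfSimilarBernoulliSqueezeSobolev
import HarnessLib

/-!
# «SUPER-FAST CHANNELS SQUEEZE VOLUME TOO FAST», Sobolev member: the rate threshold drops to `1/((2+ρ)(1+ρ))`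
# (crux `EulerZoomLiouville.PowerGaugeEulerLiouville` = stmt-NavierStokesRegularity-19832, line `birth`, THE ONE STATEMENT)

Route №10 `EulerZoomLiouville` (NavierStokesRegularity); LEAD ns-typeII-p2 g12.  Member glue of two landed pieces:

* the LEAD's (g11) SOBOLEV THINNESS of the FAST SET `{‖V y‖ ≥ a‖y‖}` — rate `m = 3+3ρ` from the `E`-gauge (`∫_{B_L}‖∇V‖² ≤ c_E L^{1−ρ}`,
  `NeedleThinCore.selfSimilar_shell_inputs`) through Gagliardo–Nirenberg–Sobolev `p = 2`, `p* = 6` (`Loc.volume_fastSet_inter_far_le_sobolev`, p636011),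
  instead of the rate `1+2ρ` the `A`-gauge alone gives (ns-ezl-w5 g0 `Loc.volume_fastSet_inter_far_le`);
* width seat ns-ezl-w5 g0's (C2) VOLUME SQUEEZE in its vortical form (`Loc.curl_eq_zero_of_vorticalFastChannel_of_thin`, p635086: backward orbits of
  vortical Bernoulli-high points escape like `e^{c₁t}` inside the high set, whose far part is thin with rate `m`, while the similarity flow contracts volume
  only like `e^{−3γt}` — absurd when `3γ < c₁ m`) and its reduction «an unpressurised high set is fast» (`Loc.bernoulliHigh_subset_fastSet_of_pressure_le`, p632961).

* **`Loc.selfSimilar_ae_eq_zero_of_vorticalFastChannelC2_profile_sobolev`** — MEMBER LEVEL, crux hypotheses verbatim (`0 < ρ ≤ ½`, `γ = 1/(2+ρ)`) +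
  exact self-similarity + `V ∈ C²` of linear growth `‖V y‖ ≤ K₁(1+‖y‖)` + for every classical pressure `P′` of `V`: an UNPRESSURISED far field
  (`P′(y) ≤ ε‖y‖²` for `‖y‖ ≥ R₁`, `ε ≤ γ(1−2γ)/4`) and, beyond some radius, the channel bound `⟪y, γy + V y⟫ ≤ −c₁‖y‖²` at every VORTICAL point of every
  high set `{ℋ_{P′} > h}`, with ONE rate `c₁ > 1/((2+ρ)(1+ρ))` ⇒ `u = 0` a.e. on `(−∞,0) × ℝ³`.  Race: `3γ < c₁(3+3ρ) ⟺ c₁(2+ρ)(1+ρ) > 1`.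
  CONSEQUENCE for THE ONE STATEMENT's portrait: in the unpressurised branch a RADIAL Bernoulli-high channel (`s − γ ≥ √(γ(1−γ))`, LEAD g11 p624179) is
  now ALWAYS super-fast enough, since `√(γ(1−γ))·(2+ρ)(1+ρ) = (1+ρ)^{3/2} > 1`; the surviving unpressurised needles have NON-RADIAL high sets (large
  tangential speed or outward high jets) or super-linear growth.

HONEST LABEL: PARTIAL model-class stratum (unpressurised far field, linear growth, uniformly fast vortical high set); the pressurised marginal channels of
THE ONE STATEMENT are untouched.  WHAT THIS IS NOT: not NS, not E — a classical sub-stratum `--supports` stmt-19832 on the MODEL lattice; 19832 OPEN;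
NS regularity NOT proved. [folklore; ConstantinIgnatovaVicol2026Putative §3.4.1, §3.4.3 (3.30); GNS inequality]
-/

noncomputable section

-- flat `Theorems/<Route><Decl>…` files of one crux share the namespace of the crux (tree convention)
set_option linter.dupNamespace false

open MeasureTheory Set Filter Topology Metric Function InnerProductSpace
open scoped RealInnerProductSpace NNReal ENNReal ContDiff

namespace Summit.NavierStokesRegularity.NavierStokesRegularity.Theorems.PowerGaugeEulerLiouville.Loc

open Literature.Analysis Literature.Analysis.FluidPDE Literature.Analysis.FunctionSpaces

/-- **EXACTLY SELF-SIMILAR MEMBERS WHOSE `C²` PROFILE OF LINEAR GROWTH HAS AN UNPRESSURISED FAR FIELD AND A FAR VORTICAL CHANNEL OF RATE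
`c₁ > 1/((2+ρ)(1+ρ))` ARE TRIVIAL** (crux hypotheses verbatim, `0 < ρ ≤ ½`; `γ = 1/(2+ρ)`).  Hypotheses on the profile: `V ∈ C²`, `‖V y‖ ≤ K₁(1+‖y‖)`;
for EVERY classical pressure `P′` of `V` (CIV (3.3)): `P′(y) ≤ ε‖y‖²` for `‖y‖ ≥ R₁` with `ε ≤ γ(1−2γ)/4`, and for every level `h` a radius beyond which
every VORTICAL point of `{ℋ_{P′} > h}` has `⟪y, γy + V y⟫ ≤ −c₁‖y‖²`.  Then `u = 0` a.e. on `(−∞,0) × ℝ³`.  (Sobolev thinness `m = 3+3ρ` of the fast set from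
the `E`-gauge; high ⊆ fast far out; the vortical squeeze; the irrotational `C²` stratum.) [folklore; GNS inequality] -/
theorem selfSimilar_ae_eq_zero_of_vorticalFastChannelC2_profile_sobolev {ρ : ℝ} (hρ : 0 < ρ) (hρ1 : ρ ≤ 1 / 2)
    {u : ℝ → EuclideanSpace ℝ (Fin 3) → EuclideanSpace ℝ (Fin 3)} {p : ℝ → EuclideanSpace ℝ (Fin 3) → ℝ}
    {H : ℝ → EuclideanSpace ℝ (Fin 3) → EuclideanSpace ℝ (Fin 3) →L[ℝ] EuclideanSpace ℝ (Fin 3)} {c : ℝ≥0}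
    (hsw : IsSuitableWeakSolutionOn (slab (EuclideanSpace ℝ (Fin 3)) (Iio 0) isOpen_Iio) 0 0 u p)
    (hH : HasWeakSpatialGradientOn (slab (EuclideanSpace ℝ (Fin 3)) (Iio 0) isOpen_Iio) u H)
    (hgauge : ∀ a : ℝ, 0 < a →
      ENNReal.ofReal (a ^ (2 * ρ)) * cknA a (0 : ℝ × EuclideanSpace ℝ (Fin 3)) u +
          ENNReal.ofReal (a ^ ρ) * cknE a (0 : ℝ × EuclideanSpace ℝ (Fin 3)) H +
        ENNReal.ofReal (a ^ (2 * ρ)) * cknD a (0 : ℝ × EuclideanSpace ℝ (Fin 3)) p ≤ (c : ℝ≥0∞))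
    {V : EuclideanSpace ℝ (Fin 3) → EuclideanSpace ℝ (Fin 3)} {P : EuclideanSpace ℝ (Fin 3) → ℝ}
    (hu : ∀ τ : ℝ, τ < 0 → u τ = selfSimilarCollapse (1 / (2 + ρ)) 0 V τ)
    (hp : ∀ τ : ℝ, τ < 0 → p τ = selfSimilarCollapsePressure (1 / (2 + ρ)) 0 P τ)
    (hV : ContDiff ℝ 2 V) {K₁ : ℝ} (hK₁ : ∀ y : EuclideanSpace ℝ (Fin 3), ‖V y‖ ≤ K₁ * (1 + ‖y‖))
    {c₁ : ℝ} (hc₁ : 1 / ((2 + ρ) * (1 + ρ)) < c₁)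
    (hB : ∀ P' : EuclideanSpace ℝ (Fin 3) → ℝ, IsSelfSimilarEulerProfile (1 / (2 + ρ)) 0 V P' →
      (∃ ε R₁ : ℝ, ε ≤ (1 / (2 + ρ)) * (1 - 2 * (1 / (2 + ρ))) / 4 ∧
        ∀ y : EuclideanSpace ℝ (Fin 3), R₁ ≤ ‖y‖ → P' y ≤ ε * ‖y‖ ^ 2) ∧
      (∀ h : ℝ, ∃ R₀ : ℝ, ∀ y : EuclideanSpace ℝ (Fin 3), R₀ ≤ ‖y‖ →
        h < selfSimilarBernoulli (1 / (2 + ρ)) 0 V P' y → curl V y ≠ 0 →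
          ⟪y, selfSimilarTransport (1 / (2 + ρ)) 0 V y⟫ ≤ -(c₁ * ‖y‖ ^ 2))) :
    uncurry u =ᵐ[volume.restrict (Iio (0 : ℝ) ×ˢ (univ : Set (EuclideanSpace ℝ (Fin 3))))] 0 := by
  -- adapted from `Loc.selfSimilar_ae_eq_zero_of_fastChannelC2_profile` (…SelfSimilarBernoulliSqueezeMember, ns-ezl-w5 g0)
  have hρ1' : ρ < 1 := by linarith
  have h2ρ : (0 : ℝ) < 2 + ρ := by linarith
  have hγ : (0 : ℝ) < 1 / (2 + ρ) := one_div_pos.2 h2ρ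
  have hγ2 : 1 / (2 + ρ) < 1 / 2 := one_div_lt_one_div_of_lt two_pos (by linarith)
  have hA : ∀ a : ℝ, 0 < a → ENNReal.ofReal (a ^ (2 * ρ)) *
      cknA a (0 : ℝ × EuclideanSpace ℝ (Fin 3)) u ≤ (c : ℝ≥0∞) :=
    fun a ha => le_trans (le_trans le_self_add le_self_add) (hgauge a ha)
  have hD : ∀ a : ℝ, 0 < a → ENNReal.ofReal (a ^ (2 * ρ)) *
      cknD a (0 : ℝ × EuclideanSpace ℝ (Fin 3)) p ≤ (c : ℝ≥0∞) :=
    fun a ha => le_trans le_add_self (hgauge a ha)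
  have hpm : AEStronglyMeasurable (uncurry p)
      (volume.restrict (Iio (0 : ℝ) ×ˢ (univ : Set (EuclideanSpace ℝ (Fin 3))))) := by
    have := hsw.distributional.2.2.1.aestronglyMeasurable
    simpa [slab] using this
  have hPm := aestronglyMeasurable_pressureProfile hpm hp
  have hDprof := profile_pressure_weight_of_gaugeD hρ hρ1' hpm hp hD
  have hP1 : LocallyIntegrable P volume :=
    EnergySaturation.locallyIntegrable_pressure_of_weight hρ1' hPm
      (ENNReal.mul_ne_top ENNReal.ofReal_ne_top ENNReal.coe_ne_top) hDprof
  obtain ⟨P', hprof⟩ := WeakToClassical.exists_isSelfSimilarEulerProfile_of_contDiff hsw.distributional hu hp hV hP1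
  obtain ⟨⟨ε, R₁, hε, hPε⟩, hfast⟩ := hB P' hprof
  -- the `A`- and `E`-gauge data of the profile (ns-ezl-w1 g2 `NeedleThinCore.selfSimilar_shell_inputs`)
  have hV1 : ContDiff ℝ 1 V := hV.of_le (by norm_num)
  have hin := fun (R : ℝ) (hR : 0 < R) =>
    NeedleThinCore.selfSimilar_shell_inputs hρ hρ1' hsw hH hgauge hu hp hV1 hR
  have hEprof : ∀ L : ℝ, 0 < L → ∫⁻ y in ball (0 : EuclideanSpace ℝ (Fin 3)) L, ‖fderiv ℝ V y‖ₑ ^ 2 ≤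
      ENNReal.ofReal ((1 - ρ) / (2 + ρ) * c * L ^ (1 - ρ)) := fun L hL => (hin L hL).1
  have hAprof : ∀ L : ℝ, 0 < L → ∫⁻ y in ball (0 : EuclideanSpace ℝ (Fin 3)) L, ‖V y‖ₑ ^ 2 ≤
      ENNReal.ofReal (c * L ^ (1 - 2 * ρ)) := fun L hL => (hin L hL).2
  have hcA : (0 : ℝ) ≤ c := NNReal.coe_nonneg c
  have hcE : (0 : ℝ) ≤ (1 - ρ) / (2 + ρ) * c := by
    have : (0 : ℝ) ≤ (1 - ρ) / (2 + ρ) := div_nonneg (by linarith) h2ρ.le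
    exact mul_nonneg this hcA
  -- SOBOLEV THINNESS of the fast set, rate `3 + 3ρ` (LEAD g11 p636011)
  set a : ℝ := (Real.sqrt ((1 / (2 + ρ)) / 2) - 1 / (2 + ρ)) / 2 with hadef
  have hsq : 1 / (2 + ρ) < Real.sqrt ((1 / (2 + ρ)) / 2) := by
    rw [Real.lt_sqrt hγ.le]; nlinarith
  have ha : 0 < a := by rw [hadef]; linarith
  obtain ⟨K', -, hfar⟩ := volume_fastSet_inter_far_le_sobolev (ρ := ρ) (by linarith) hV1 hcA hcE hAprof hEprof ha
  have hthin : ∀ h : ℝ, ∃ C R₂ : ℝ, 0 < R₂ ∧ ∀ R : ℝ, R₂ ≤ R →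
      volume ({y : EuclideanSpace ℝ (Fin 3) | h < selfSimilarBernoulli (1 / (2 + ρ)) 0 V P' y} ∩ {y | R ≤ ‖y‖}) ≤
        ENNReal.ofReal (C * R ^ (-(3 + 3 * ρ))) := by
    intro h
    obtain ⟨R₃, hR₃⟩ := bernoulliHigh_subset_fastSet_of_pressure_le hγ hγ2 hε hPε h
    refine ⟨K', max R₃ 1, by positivity, fun R hR => ?_⟩
    have hR1 : 1 ≤ R := (le_max_right _ _).trans hR
    have hsub : {y : EuclideanSpace ℝ (Fin 3) | h < selfSimilarBernoulli (1 / (2 + ρ)) 0 V P' y} ∩ {y | R ≤ ‖y‖} ⊆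
        {y : EuclideanSpace ℝ (Fin 3) | a * ‖y‖ ≤ ‖V y‖} ∩ {y | R ≤ ‖y‖} := by
      rintro y ⟨hy, hyR⟩
      exact ⟨hR₃ y (((le_max_left _ _).trans hR).trans hyR) hy, hyR⟩
    refine (measure_mono hsub).trans ?_
    rw [show -(3 + 3 * ρ) = -3 - 3 * ρ by ring]
    exact hfar R hR1
  -- the race `3γ < c₁ (3 + 3ρ)`, i.e. `1 < c₁ (2+ρ)(1+ρ)`
  have hrace : 3 * (1 / (2 + ρ)) < c₁ * (3 + 3 * ρ) := by
    have h1ρ : (0 : ℝ) < 1 + ρ := by linarith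
    have h1 := (div_lt_iff₀ (by positivity : (0 : ℝ) < (2 + ρ) * (1 + ρ))).1 hc₁
    rw [show 3 * (1 / (2 + ρ)) = 3 / (2 + ρ) by ring, div_lt_iff₀ h2ρ]
    nlinarith
  have hc₁0 : 0 < c₁ := lt_trans (by positivity) hc₁
  have hcurl : ∀ x, curl V x = 0 := fun x =>
    curl_eq_zero_of_vorticalFastChannel_of_thin hprof hγ hγ2 hK₁ hc₁0 hrace hthin hfast x
  exact Loc.selfSimilar_ae_eq_zero_of_irrotationalC2_profile hρ hsw.distributional hA hu hV hcurl

end Summit.NavierStokesRegularity.NavierStokesRegularity.Theorems.PowerGaugeEulerLiouville.Loc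

end
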